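import Literature.AlgebraicGeometry.Motives.ProetProductCoefficientSequence
import HarnessLib

/-!
# Finiteness of `ℓ`-adic cohomology, VI: the pro-étale `lim¹` sequence modulo exactness of
# countable products

Part V-a (`ProetProductCoefficientSequence.lean`) proved the short exact sequence of abelian
sheaves `0 → F_{ℤ_ℓ} —ι→ F_{∏ℤ/ℓᵐ} —τ→ F_{∏ℤ/ℓᵐ} → 0` on `Y_proét` (`τ = 1 - shift`). Its long exact
cohomology sequence (`ProetCohomology.δ`, `exact₁/₂/₃` of `ProetCohomologyExactSequence.lean`, from Mathlib's
`Ext.covariant_sequence_exact₁/₂/₃` for `Sheaf.H = Ext(ℤ, –)`) yields the `lim¹` sequence of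
Bhatt–Scholze Prop. 5.6.2 *with pro-étale groups inside the limits* as soon as
`Hᵏ(Y_proét, F_{∏ℤ/ℓᵐ}) = ∏_m Hᵏ(Y_proét, ℤ/ℓᵐ)`, i.e. as soon as cohomology of the (replete) pro-étale
topos commutes with countable products (Prop. 3.1.9). That commutation is recorded as the ONE
named fact of this file, `bijective_piComparison_proetCohomology` (statement only; the only
unproved input below); everything else is proved:

* `proetCohomology_limOneSequence_of_piComparison` — injective
  `δ : lim¹_m Hⁱ(Y_proét, ℤ/ℓᵐ) → Hⁱ⁺¹_proét(Y, ℤ_ℓ)` with image the kernel of the canonical, surjective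
  `ρ : Hⁱ⁺¹_proét(Y, ℤ_ℓ) → lim_m Hⁱ⁺¹(Y_proét, ℤ/ℓᵐ)` (`ProetCohomology.toTowerLim`, the reductions);
* `ProetCohomology.eq_zero_of_forall_pow_smul_succ_of_piComparison` — separatedness of
  `Hⁱ⁺¹_proét(Y, ℤ_ℓ)` when the `Hⁱ(Y_proét, ℤ/ℓᵐ)` are finite (Mittag-Leffler, proved in
  `EllAdicComparison.lean`);
* the finiteness consequences (Milne V.1.11 for the canonical structure, and the named facts of
  the cluster from `bijective_piComparison_proetCohomology` in place of Prop. 5.6.2) are assembled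
  in `EllAdicCohomologyFinitenessFromProducts.lean`.

## References

* B. Bhatt, P. Scholze, *The pro-étale topology for schemes*, Astérisque 369 (2015) (held:
  arXiv:1309.1198): Prop. 3.1.9 ("Countable products are exact in a replete topos"), Prop. 3.1.10
  and Prop. 3.1.11 with proofs (`R lim → ∏ → ∏`, "the product computes the derived product"),
  Def. 3.2.1, Prop. 3.2.3 (1), Lemma 3.3.2 (proof: `RHom(K, R lim L_n) = R lim RHom(K, L_n)` is
  formal), Lemma 4.2.12, Prop. 4.2.8, Prop. 5.6.2, Def. 6.8.1, Lemma 6.8.2. [BhattScholze2015]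
* J. S. Milne, *Étale cohomology* (2025 reissue, held copy; PDF pages): V §1 p. 176, V Lemma 1.11
  pp. 177–178; VI Cor. 2.8 p. 238. [Milne2025]

## Design notes

* The comparison map and the fact are stated for an arbitrary sequence of topological abelian
  groups `A : ℕ → Type` (Prop. 3.1.9 is about arbitrary countable products); only `A m = ℤ/ℓᵐ` is
  used.
* `ρ` is constructed (not posited): `ProetCohomology.toTowerLim`, with components the reductions;
  `δ` is `ProetCohomology.δ` precomposed with the inverse of the comparison bijection and factored
  through `TowerLimOne` — so, unlike `ellAdicCohomology_limOneSequence`, the maps are pinned down.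
* The pro-étale tower is `proetCohomologyZModPowMap Y ℓ i : Hⁱ(Y_proét, ℤ/ℓᵐ⁺¹) → Hⁱ(Y_proét, ℤ/ℓᵐ)`
  on `proetCohomologyZModPow Y ℓ i m := ProetCohomology Y (ZMod (ℓ ^ m)) i` (`m` last, for the
  unifier, as `etaleCohomologyZModPow`).
* Not here: a comparison of the pro-étale tower with the étale tower compatible with the
  transition maps (it would derive `ellAdicCohomology_limOneSequence` itself; the vendored bridges
  `nonempty_addEquiv_…` are not natural in the coefficients).
-/

universe u

open CategoryTheory AlgebraicGeometry Limits Literature.Algebra.InverseSystem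

noncomputable section

namespace Literature.AlgebraicGeometry.Motives

section MapSub

variable (X : Scheme.{u}) {A B : Type} [TopologicalSpace A] [AddCommGroup A] [IsTopologicalAddGroup A]
  [TopologicalSpace B] [AddCommGroup B] [IsTopologicalAddGroup B]

/-- The map induced on `Hⁱ(X_proét, F_–)` by `-φ` is `-`(the map induced by `φ`)
(`ProetCohomology.map_add'` with `φ + (-φ) = 0`). [folklore] -/
theorem ProetCohomology.map_neg' (φ : A →+ B) (hφ : Continuous φ) (h : Continuous (-φ)) (i : ℕ)
    (x : ProetCohomology X A i) : map X (-φ) h i x = -map X φ hφ i x := by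
  rw [eq_neg_iff_add_eq_zero, add_comm, ← map_add' X φ (-φ) hφ h (hφ.add h),
    map_congr (add_neg_cancel φ) _ continuous_const, map_zero']

/-- The map induced by a difference `φ - ψ` is the difference of the induced maps. [folklore] -/
theorem ProetCohomology.map_sub' (φ ψ : A →+ B) (hφ : Continuous φ) (hψ : Continuous ψ)
    (h : Continuous (φ - ψ)) (i : ℕ) (x : ProetCohomology X A i) :
    map X (φ - ψ) h i x = map X φ hφ i x - map X ψ hψ i x := by
  rw [map_congr (sub_eq_add_neg φ ψ) h (hφ.add hψ.neg), map_add' X φ (-ψ) hφ hψ.neg,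
    map_neg' X ψ hψ hψ.neg, sub_eq_add_neg]

end MapSub

section Cohomology

variable (Y : Scheme.{u}) (ℓ : ℕ) [Fact ℓ.Prime]

/-- The groups `Hⁱ(Y_proét, ℤ/ℓᵐ) = ProetCohomology Y (ZMod (ℓ ^ m)) i` of the pro-étale tower, as a
function of `m` last (the argument order `towerLim`/`TowerLimOne` unify against). [folklore] -/
abbrev proetCohomologyZModPow (i m : ℕ) : Type (u + 1) := ProetCohomology Y (ZMod (ℓ ^ m)) i

/-- **The pro-étale tower** `m ↦ Hⁱ(Y_proét, ℤ/ℓᵐ)`: the transition map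
`Hⁱ(Y_proét, ℤ/ℓᵐ⁺¹) → Hⁱ(Y_proét, ℤ/ℓᵐ)` induced by the reduction of coefficients (the pro-étale
counterpart of `etaleCohomologyZModPowMap`, `EllAdicComparison.lean`). [folklore] -/
def proetCohomologyZModPowMap (i m : ℕ) :
    proetCohomologyZModPow Y ℓ i (m + 1) →+ proetCohomologyZModPow Y ℓ i m :=
  ProetCohomology.map Y (zmodPowTransition ℓ m) continuous_of_discreteTopology i

/-- **The comparison map `Hⁱ(Y_proét, F_{∏A_m}) → ∏_m Hⁱ(Y_proét, F_{A_m})`** for a sequence of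
topological abelian groups `A_m`: components induced by the continuous projections
`∏ A_m → A_m` (i.e. `Hⁱ` of `F_{∏A_m} = ∏ F_{A_m} → F_{A_m}`). [folklore] -/
def ProetCohomology.piComparison (A : ℕ → Type) [∀ m, TopologicalSpace (A m)]
    [∀ m, AddCommGroup (A m)] [∀ m, IsTopologicalAddGroup (A m)] (i : ℕ) :
    ProetCohomology Y (∀ m, A m) i →+ ∀ m, ProetCohomology Y (A m) i :=
  AddMonoidHom.pi fun m => ProetCohomology.map Y (Pi.evalAddMonoidHom A m) (continuous_apply m) i

/-- **Cohomology of `X_proét` commutes with countable products of coefficient groups** (named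
fact, statement only). For every scheme `Y`, every sequence `(A_m)_{m ∈ ℕ}` of topological abelian
groups and every `i`, the comparison map `Hⁱ(Y_proét, F_{∏_m A_m}) → ∏_m Hⁱ(Y_proét, F_{A_m})`
(`ProetCohomology.piComparison`) is bijective. Printed sources and the derivation:
`F_{∏A_m} = ∏_m F_{A_m}` as sheaves on `Y_proét` (`F_T : U ↦ Map_cont(U, T)` is a sheaf for every
space `T`, Bhatt–Scholze Lemma 4.2.12, and `Map_cont(U, ∏ A_m) = ∏ Map_cont(U, A_m)`); the topos
`Shv(Y_proét)` is locally weakly contractible (Prop. 4.2.8), hence replete (Prop. 3.2.3 (1)), so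
"countable products are exact" in it (Prop. 3.1.9) and "the product `∏_n F_n` computes the derived
product in `D`" (proof of Prop. 3.1.10); finally `RHom(K, –)` commutes with derived products —
"`RHom(K, R lim L_n) ≃ R lim RHom(K, L_n)` … \[is\] formal" (proof of Lemma 3.3.2), the product
being the special case of a constant tower up to shift, or directly: products in `D` are
categorical — and products are exact in `Ab`, so
`Extⁱ(ℤ, ∏ F_{A_m}) = Hⁱ(∏ RHom(ℤ, F_{A_m})) = ∏ Extⁱ(ℤ, F_{A_m})`, the identification being the
comparison map. Read for Mathlib's `Sheaf.H = Ext(ℤ, –)` on `Y.ProEt` (Def. 4.1.1 without the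
cardinal bound of Remark 4.1.2, coefficients lifted to `Ab.{u+1}`, the conventions of
`Scheme.EllAdicCohomology` and of all facts of this cluster); the w-contractible covers behind
Prop. 4.2.8 (Lemma 2.4.9) stay in the universe of `Y`, so the repleteness argument reads
verbatim. For the pro-étale towers `Hⁱ(Y_proét, ℤ/ℓᵐ)` this single structural statement replaces
the named fact `ellAdicCohomology_limOneSequence` (Prop. 5.6.2, stated with étale towers): see
`proetCohomology_limOneSequence_of_piComparison`. Not in Mathlib (no exactness of infinite
products in categories of sheaves, no commutation of `Ext` with products).
[cite: BhattScholze2015, Prop. 3.1.9, Prop. 3.1.10 (proof), Prop. 3.2.3, Prop. 4.2.8 and Lemma 3.3.2 (proof)] -/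
def bijective_piComparison_proetCohomology : Prop :=
  ∀ (Y : Scheme.{u}) (A : ℕ → Type) [∀ m, TopologicalSpace (A m)] [∀ m, AddCommGroup (A m)]
    [∀ m, IsTopologicalAddGroup (A m)] (i : ℕ),
    Function.Bijective (ProetCohomology.piComparison Y A i)

omit [Fact ℓ.Prime] in
/-- Naturality of the comparison map with `τ = 1 - shift`: under `Hⁱ(F_{∏ℤ/ℓᵐ}) → ∏_m Hⁱ(ℤ/ℓᵐ)`,
`Hⁱ(τ)` becomes `towerDiff` of the pro-étale tower (componentwise
`pr_m ∘ τ = pr_m - red ∘ pr_{m+1}`, and `Hⁱ` is additive and functorial in the coefficients).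
[folklore] -/
theorem piComparison_map_prodTowerDiff (i : ℕ) (x : ProetCohomology Y (ZModPowProd ℓ) i) :
    ProetCohomology.piComparison Y (fun m => ZMod (ℓ ^ m)) i
        (ProetCohomology.map Y (prodTowerDiff ℓ) (continuous_prodTowerDiff ℓ) i x) =
      towerDiff (proetCohomologyZModPowMap Y ℓ i)
        (ProetCohomology.piComparison Y (fun m => ZMod (ℓ ^ m)) i x) := by
  funext m
  have h1 : Continuous ((Pi.evalAddMonoidHom (fun m => ZMod (ℓ ^ m)) m).comp (prodTowerDiff ℓ)) :=
    (continuous_apply m).comp (continuous_prodTowerDiff ℓ)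
  have h2 : Continuous
      ((zmodPowTransition ℓ m).comp (Pi.evalAddMonoidHom (fun m => ZMod (ℓ ^ m)) (m + 1))) :=
    Continuous.comp (g := zmodPowTransition ℓ m) continuous_of_discreteTopology (continuous_apply (m + 1))
  have h3 : Continuous (Pi.evalAddMonoidHom (fun m => ZMod (ℓ ^ m)) m -
      (zmodPowTransition ℓ m).comp (Pi.evalAddMonoidHom (fun m => ZMod (ℓ ^ m)) (m + 1))) :=
    (continuous_apply m).sub h2
  have heq : (Pi.evalAddMonoidHom (fun m => ZMod (ℓ ^ m)) m).comp (prodTowerDiff ℓ) =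
      Pi.evalAddMonoidHom (fun m => ZMod (ℓ ^ m)) m -
        (zmodPowTransition ℓ m).comp (Pi.evalAddMonoidHom (fun m => ZMod (ℓ ^ m)) (m + 1)) := by
    ext a
    simp
  change ProetCohomology.map Y _ _ i (ProetCohomology.map Y _ _ i x) =
    ProetCohomology.map Y _ _ i x -
      ProetCohomology.map Y (zmodPowTransition ℓ m) _ i (ProetCohomology.map Y _ _ i x)
  rw [← ProetCohomology.map_comp Y _ (continuous_prodTowerDiff ℓ) _ (continuous_apply m) h1,
    ProetCohomology.map_congr heq h1 h3, ProetCohomology.map_sub' Y _ _ (continuous_apply m) h2 h3,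
    ProetCohomology.map_comp Y _ (continuous_apply (m + 1)) _ continuous_of_discreteTopology h2]

/-- Under the comparison map, `Hⁱ(ι) : Hⁱ(ℤ_ℓ) → Hⁱ(F_{∏ℤ/ℓᵐ})` has components the reductions
`Hⁱ(Y_proét, ℤ_ℓ) → Hⁱ(Y_proét, ℤ/ℓᵐ)` (`pr_m ∘ ι = red_m`). [folklore] -/
theorem piComparison_map_toZModPowProd (i : ℕ) (z : ProetCohomology Y ℤ_[ℓ] i) (m : ℕ) :
    ProetCohomology.piComparison Y (fun m => ZMod (ℓ ^ m)) i
        (ProetCohomology.map Y (toZModPowProd ℓ) (continuous_toZModPowProd ℓ) i z) m =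
      ProetCohomology.map Y (reductionHom ℓ m) (continuous_reductionHom ℓ m) i z := by
  change ProetCohomology.map Y _ _ i (ProetCohomology.map Y _ _ i z) = _
  rw [← ProetCohomology.map_comp Y _ _ _ _ ((continuous_apply m).comp (continuous_toZModPowProd ℓ))]
  exact ProetCohomology.map_congr (by ext a; rfl) _ _ i z

end Cohomology

/-! ### The pro-étale `lim¹` sequence -/

section LimOne

variable (Y : Scheme.{u}) (ℓ : ℕ) [Fact ℓ.Prime]

/-- **The canonical map `ρ : Hⁱ_proét(Y, ℤ_ℓ) → lim_m Hⁱ(Y_proét, ℤ/ℓᵐ)`**, `z ↦ (z mod ℓᵐ)_m` (the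
comparison map after `Hⁱ(ι)`, landing in `towerLim` because `Hⁱ(τ) ∘ Hⁱ(ι) = 0`). [folklore] -/
def ProetCohomology.toTowerLim (i : ℕ) :
    ProetCohomology Y ℤ_[ℓ] i →+ towerLim (proetCohomologyZModPowMap Y ℓ i) :=
  ((ProetCohomology.piComparison Y (fun m => ZMod (ℓ ^ m)) i).comp
    (ProetCohomology.map Y (toZModPowProd ℓ) (continuous_toZModPowProd ℓ) i)).codRestrict
    (towerLim _) fun z => by
      rw [towerLim, AddMonoidHom.mem_ker, AddMonoidHom.comp_apply, ← piComparison_map_prodTowerDiff,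
        ProetCohomology.map_map_eq_zero Y (isContinuousShortExact_toZModPowProd ℓ) i z, map_zero]

/-- Components of `ρ`: the reductions `Hⁱ(Y_proét, ℤ_ℓ) → Hⁱ(Y_proét, ℤ/ℓᵐ)`. [folklore] -/
theorem ProetCohomology.coe_toTowerLim_apply (i : ℕ) (z : ProetCohomology Y ℤ_[ℓ] i) (m : ℕ) :
    (ProetCohomology.toTowerLim Y ℓ i z : ∀ m, ProetCohomology Y (ZMod (ℓ ^ m)) i) m =
      ProetCohomology.map Y (reductionHom ℓ m) (continuous_reductionHom ℓ m) i z :=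
  piComparison_map_toZModPowProd Y ℓ i z m

/-- **The pro-étale `lim¹` sequence**
`0 → lim¹_m Hⁱ(Y_proét, ℤ/ℓᵐ) —δ→ Hⁱ⁺¹_proét(Y, ℤ_ℓ) —ρ→ lim_m Hⁱ⁺¹(Y_proét, ℤ/ℓᵐ) → 0`, modulo the
commutation of `Hⁱ(Y_proét, –)` with countable products (`bijective_piComparison_proetCohomology`):
there is an injective `δ` from `TowerLimOne` of the pro-étale tower with image the kernel of the
canonical `ρ = ProetCohomology.toTowerLim`, which is surjective. Real proof: the long exact
`Ext`-sequence of the PROVED short exact sequence `0 → F_{ℤ_ℓ} → F_{∏ℤ/ℓᵐ} → F_{∏ℤ/ℓᵐ} → 0`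
(`prodShortComplex_shortExact`, Part V-a; `ProetCohomology.δ`, `exact₁/₂/₃`) —
`Hⁱ(F_∏) —τ→ Hⁱ(F_∏) —δ→ Hⁱ⁺¹(ℤ_ℓ) —ι→ Hⁱ⁺¹(F_∏) —τ→ Hⁱ⁺¹(F_∏)` — with `Hᵏ(F_{∏ℤ/ℓᵐ}) ≅ ∏_m Hᵏ(ℤ/ℓᵐ)` carrying `Hᵏ(τ)` to `towerDiff`
(`piComparison_map_prodTowerDiff`), so that `coker Hⁱ(τ) = lim¹` and `ker Hⁱ⁺¹(τ) = lim`. This is the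
argument of Bhatt–Scholze Prop. 5.6.2 / 3.1.10–3.1.11 (`R lim → ∏ → ∏`) run inside `X_proét` for the
tower `(ℤ/ℓᵐ)_m`, pro-étale groups inside the limits.
[cite: BhattScholze2015, Prop. 5.6.2, Prop. 3.1.10 and Prop. 3.1.11] -/
theorem proetCohomology_limOneSequence_of_piComparison
    (hpi : bijective_piComparison_proetCohomology.{u}) (i : ℕ) :
    ∃ δ : TowerLimOne (proetCohomologyZModPowMap Y ℓ i) →+ ProetCohomology Y ℤ_[ℓ] (i + 1),
      Function.Injective δ ∧ Function.Surjective (ProetCohomology.toTowerLim Y ℓ (i + 1)) ∧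
        δ.range = (ProetCohomology.toTowerLim Y ℓ (i + 1)).ker := by
  have hP := fun k => hpi Y (fun m => ZMod (ℓ ^ m)) k
  have hS := isContinuousShortExact_toZModPowProd ℓ
  let e : ∀ k, ProetCohomology Y (ZModPowProd ℓ) k ≃+ (∀ m, ProetCohomology Y (ZMod (ℓ ^ m)) k) :=
    fun k => AddEquiv.ofBijective _ (hP k)
  have he : ∀ k x, e k x = ProetCohomology.piComparison Y (fun m => ZMod (ℓ ^ m)) k x :=
    fun k x => rfl
  -- the connecting map vanishes on the image of `towerDiff`
  have hvan : (towerDiff (proetCohomologyZModPowMap Y ℓ i)).range ≤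
      ((ProetCohomology.δ Y hS i (i + 1) rfl).comp (e i).symm.toAddMonoidHom).ker := by
    rintro _ ⟨y, rfl⟩
    obtain ⟨x, rfl⟩ := (e i).surjective y
    rw [AddMonoidHom.mem_ker, AddMonoidHom.comp_apply, he, ← piComparison_map_prodTowerDiff,
      ← he, AddEquiv.coe_toAddMonoidHom, AddEquiv.symm_apply_apply]
    exact ProetCohomology.δ_map_eq_zero Y hS i (i + 1) rfl x
  let δ : TowerLimOne (proetCohomologyZModPowMap Y ℓ i) →+ ProetCohomology Y ℤ_[ℓ] (i + 1) :=
    QuotientAddGroup.lift _ ((ProetCohomology.δ Y hS i (i + 1) rfl).comp (e i).symm.toAddMonoidHom) hvan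
  have hδ : ∀ y, δ (TowerLimOne.mk _ y) = ProetCohomology.δ Y hS i (i + 1) rfl ((e i).symm y) :=
    fun y => rfl
  refine ⟨δ, ?_, ?_, ?_⟩
  · -- `δ` is injective: exactness at `Hⁱ(F_∏)`
    rw [injective_iff_map_eq_zero]
    intro q hq
    obtain ⟨y, rfl⟩ := TowerLimOne.mk_surjective _ q
    rw [hδ] at hq
    obtain ⟨w, hw⟩ := ProetCohomology.exact₃ Y hS rfl _ hq
    rw [TowerLimOne.mk_eq_zero_iff]
    refine ⟨e i w, ?_⟩
    rw [he, ← piComparison_map_prodTowerDiff, hw, ← he, AddEquiv.apply_symm_apply]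
  · -- `ρ` is surjective: exactness at `Hⁱ⁺¹(F_∏)`
    intro c
    obtain ⟨x₂, hx₂⟩ := (e (i + 1)).surjective (c : ∀ m, ProetCohomology Y (ZMod (ℓ ^ m)) (i + 1))
    have hτ : ProetCohomology.map Y (prodTowerDiff ℓ) (continuous_prodTowerDiff ℓ) (i + 1) x₂ = 0 := by
      apply (hP (i + 1)).1
      rw [map_zero, piComparison_map_prodTowerDiff, ← he, hx₂]
      exact (AddMonoidHom.mem_ker).1 c.2
    obtain ⟨z, hz⟩ := ProetCohomology.exact₂ Y hS x₂ hτ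
    refine ⟨z, Subtype.ext ?_⟩
    change ProetCohomology.piComparison Y (fun m => ZMod (ℓ ^ m)) (i + 1)
      (ProetCohomology.map Y (toZModPowProd ℓ) (continuous_toZModPowProd ℓ) (i + 1) z) = c
    rw [hz, ← he, hx₂]
  · -- `range δ = ker ρ`: exactness at `Hⁱ⁺¹(F_{ℤ_ℓ})`
    ext z
    constructor
    · rintro ⟨q, rfl⟩
      obtain ⟨y, rfl⟩ := TowerLimOne.mk_surjective _ q
      rw [AddMonoidHom.mem_ker, hδ]
      refine Subtype.ext ?_
      change ProetCohomology.piComparison Y (fun m => ZMod (ℓ ^ m)) (i + 1)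
        (ProetCohomology.map Y (toZModPowProd ℓ) (continuous_toZModPowProd ℓ) (i + 1)
          (ProetCohomology.δ Y hS i (i + 1) rfl ((e i).symm y))) = 0
      rw [ProetCohomology.map_δ_eq_zero, map_zero]
    · intro hz
      have h0 : ProetCohomology.map Y (toZModPowProd ℓ) (continuous_toZModPowProd ℓ) (i + 1) z
          = 0 := by
        apply (hP (i + 1)).1
        rw [map_zero]
        exact congrArg Subtype.val ((AddMonoidHom.mem_ker).1 hz)
      obtain ⟨x, rfl⟩ := ProetCohomology.exact₁ Y hS rfl z h0
      refine ⟨TowerLimOne.mk _ (e i x), ?_⟩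
      rw [hδ, AddEquiv.symm_apply_apply]

end LimOne



end Literature.AlgebraicGeometry.Motives

end
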